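import Literature.MathematicalPhysics.QuantumLattice.HubbardSpinMomentBounds
import Summits.HubbardSuperconductivity.HubbardLadder.HubbardSpinCorrelationSignRows
import Mathlib.Analysis.SpecialFunctions.Complex.CircleAddChar

/-!
# M3 observables (iii): spin / charge structure factors and per-displacement correlators on the
# `L × L` Hubbard torus, every `L`

HONEST FRAMING: first certified bounds; not a superconductivity verdict; every number
certified or labelled float.  This file contains OBJECTS and their exact DICTIONARY only — no
bound on any Hubbard ground state is claimed here.

Speedrun `mbsolver`, M3 canonical point (`U = 8t`, `n = 7/8`, `t′ ∈ {0, −1/4}`); stripe-rows seat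
sr-mbsolver-m3-7 (request M3-L1 of `run/shared/lean/speedrun/mbsolver/M3.md` §2(iii), lead D-11 P4;
plan of record `…/sr-mbsolver-m3-7/STRIPE-ROWS.md`).  The `4 × 4` objects of
`Summit.HubbardSuperconductivity.HubbardLadder.spinStructureFour` are the case `L = 4`
(`spinStructureOp_four`).

## Objects (torus `𝕋_L = (ℤ/Lℤ)²`, sites `FermionTorus.ofTorusSite x`, `N_s = L²`)

* `siteDensity x = n_{x↑} + n_{x↓}`;
* `spinCorrSum L r = W_r = Σ_x 𝐒_x·𝐒_{x+r}` (FULL `SU(2)` dot product `fermionSpinDot`) and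
  `densityCorrSum L r = N_r = Σ_x n_x n_{x+r}`, `r ∈ 𝕋_L`;
* `spinCorr L r ψ = C_s(r; ψ) = Re ⟨ψ, W_r ψ⟩ / L²`, `densityCorr L r ψ = C_c(r; ψ) = Re ⟨ψ, N_r ψ⟩ / L²`
  (M3.md §4 row ids `Cs.r<dx>_<dy>`, `Cc.r<dx>_<dy>`; NOT connected: the product of densities
  `ω(n_x) ω(n_y)` is subtracted by the row writer, it is `n²` in a fixed-density state);
* `torusDot L k x = k·x ∈ ℤ/Lℤ`, `blochPhase L k x = e^{2πi k·x/L}` (`ZMod.stdAddChar`), momenta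
  `q = 2πk/L`, `k ∈ 𝕋_L`;
* `spinStructureOp L k = 𝓢_s(q) = Σ_{x,y} e^{iq·x} e^{-iq·y} 𝐒_x·𝐒_y`,
  `densityStructureOp L k = 𝓢_c(q) = Σ_{x,y} e^{iq·x} e^{-iq·y} n_x n_y`;
* `spinStructureFactor L k ψ = S_s(q; ψ) = Re ⟨ψ, 𝓢_s(q) ψ⟩ / L²`,
  `densityStructureFactor L k ψ = S_c(q; ψ) = Re ⟨ψ, 𝓢_c(q) ψ⟩ / L²` (row ids `Ss.q<label>`,
  `Sc.q<label>`; at `q ≠ 0` in a translation-invariant fixed-`N` state the latter IS the connected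
  charge structure factor, the subtracted term having zero Fourier coefficient).
Conventions: Hirsch, PRB 31 (1985) 4403, eq. (4.7); Qin–Shi–Zhang, PRB 94 (2016) 085103 §IV;
Scalapino, Phys. Rep. 250 (1995) 329 §2.

## Dictionary (all `L`, all vectors `ψ`; exact identities, no hypotheses on `ψ`)

* `spinStructureOp_eq_sum_smul_spinCorrSum`: `𝓢_s(q) = Σ_r e^{-iq·r} W_r` (Fourier / Wiener–Khinchin
  on the finite torus); `spinCorrSum_neg`: `W_{-r} = W_r` (`𝐒_x·𝐒_y = 𝐒_y·𝐒_x`); hence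
  `spinStructureOp_eq_sum_re_smul`: `𝓢_s(q) = Σ_r cos(q·r) W_r` and
  `spinStructureFactor_eq_sum_cos_mul_spinCorr`: **`S_s(q; ψ) = Σ_r cos(2π (k·r)/L) C_s(r; ψ)`** — the
  STAR-SYMMETRISED cosine weights of the cell's `sfweights` tables; same for the density.
* `spinStructureOp_four`: at `L = 4`, `spinStructureOp 4 k = spinStructureFour (ofTorusSite k)`.
* `spinCorrSum_zero`: `W_0 = (3/4) Σ_x m_x` (local-moment sum rule, the `r = 0` entry of every
  truncated structure factor).

The state-side dictionary (translation / point-group averaging = `orbitState`, window objectives,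
the thermodynamic-limit handle `torusAvgExpectAt`) is the companion file
`Observables/StructureFactorsAveraging.lean`.
-/

noncomputable section

namespace Summit.Ventures.CertifiedManyBodySolver.Observables

open Matrix Literature.MathematicalPhysics.QuantumLattice Literature.Probability.LatticeModels
open Literature.MathematicalPhysics.QuantumLattice.HubbardWave0
open Literature.MathematicalPhysics.QuantumLattice.FermionTorus
open scoped BigOperators ComplexConjugate

/-! ## Site density -/

section SiteDensity

variable {Λ : Type*} [LinearOrder Λ] [Fintype Λ]

/-- **The site density** `n_x = n_{x↑} + n_{x↓}`. Hirsch 1985 eq. (4.7) (charge channel). -/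
def siteDensity (x : Λ) : Matrix (Finset (Orb Λ)) (Finset (Orb Λ)) ℂ :=
  numberOp x 0 + numberOp x 1

/-- `n_x` unfolded. -/
theorem siteDensity_def (x : Λ) : siteDensity x = numberOp x 0 + numberOp x 1 := rfl

/-- Site densities commute (`n_{xσ} n_{yτ} = n_{yτ} n_{xσ}`, all diagonal in the occupation basis). -/
theorem siteDensity_commute (x y : Λ) : Commute (siteDensity x) (siteDensity y) := by
  have h : ∀ σ τ : Fin 2, Commute (numberOp x σ) (numberOp y τ) := fun σ τ =>
    numberAt_commute (orb x σ) (orb y τ)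
  exact ((h 0 0).add_right (h 0 1)).add_left ((h 1 0).add_right (h 1 1))

/-- `n_x` is Hermitian. -/
theorem conjTranspose_siteDensity (x : Λ) : (siteDensity x)ᴴ = siteDensity x := by
  simp only [siteDensity, numberOp, conjTranspose_add, conjTranspose_mul, annihilation_conjTranspose,
    creation_conjTranspose]

variable {Λ' : Type*} [LinearOrder Λ'] [Fintype Λ']

/-- `Γ(f) n_x Γ(f)⁻¹ = n_{f x}` (covariance under site bijections). -/
theorem relabel_mapEquiv_siteDensity (f : Λ ≃ Λ') (x : Λ) :
    relabel (Orb.mapEquiv f) (siteDensity x) = siteDensity (f x) := by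
  rw [siteDensity, siteDensity, map_add, relabel_mapEquiv_numberOp, relabel_mapEquiv_numberOp]

/-- `Γ(φ) n_x = n_{φ x}` (isotony / covariance of the local algebras). -/
theorem fermionEmbed_siteDensity (φ : Λ ↪ Λ') (x : Λ) :
    fermionEmbed φ (siteDensity x) = siteDensity (φ x) := by
  rw [siteDensity, siteDensity, map_add, fermionEmbed_numberOp, fermionEmbed_numberOp]

end SiteDensity

/-! ## Torus objects: `W_r`, `N_r`, Bloch phases, `𝓢_s(q)`, `𝓢_c(q)` and the per-site functionals -/

section Torus

variable (L : ℕ) [NeZero L]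

/-- **`W_r = Σ_x 𝐒_x·𝐒_{x+r}`**, the translation-summed spin correlator at displacement `r ∈ (ℤ/Lℤ)²`
(full `SU(2)` dot product). Hirsch 1985 eq. (4.7); M3.md §2(iii). -/
def spinCorrSum (r : TorusSite 2 L) :
    Matrix (Finset (Orb (FermionTorus 2 L))) (Finset (Orb (FermionTorus 2 L))) ℂ :=
  ∑ x : TorusSite 2 L, fermionSpinDot (ofTorusSite x) (ofTorusSite (x + r))

/-- **`N_r = Σ_x n_x n_{x+r}`**, the translation-summed density correlator at displacement `r`.
Hirsch 1985 eq. (4.7); M3.md §2(iii). -/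
def densityCorrSum (r : TorusSite 2 L) :
    Matrix (Finset (Orb (FermionTorus 2 L))) (Finset (Orb (FermionTorus 2 L))) ℂ :=
  ∑ x : TorusSite 2 L, siteDensity (ofTorusSite x) * siteDensity (ofTorusSite (x + r))

/-- **`C_s(r; ψ) = Re ⟨ψ, W_r ψ⟩ / L²`**, the per-site spin correlator of a torus vector at
displacement `r` (row id `Cs.r<dx>_<dy>`; `ψ` is meant to be a unit vector). -/
def spinCorr (r : TorusSite 2 L) (ψ : Fock (Orb (FermionTorus 2 L))) : ℝ :=
  (expect (spinCorrSum L r) ψ).re / (L : ℝ) ^ 2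

/-- **`C_c(r; ψ) = Re ⟨ψ, N_r ψ⟩ / L²`**, the per-site (non-connected) density correlator of a torus
vector at displacement `r` (row id `Cc.r<dx>_<dy>`). -/
def densityCorr (r : TorusSite 2 L) (ψ : Fock (Orb (FermionTorus 2 L))) : ℝ :=
  (expect (densityCorrSum L r) ψ).re / (L : ℝ) ^ 2

/-- `k·x = Σ_i k_i x_i ∈ ℤ/Lℤ` for a momentum index `k` and a site `x` of the torus. -/
def torusDot (k x : TorusSite 2 L) : ZMod L := ∑ i, k i * x i

/-- **The Bloch phase `e^{iq·x} = e^{2πi (k·x)/L}`**, `q = 2πk/L` (the standard additive character of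
`ℤ/Lℤ` at `k·x`). Hirsch 1985 eq. (4.7). -/
def blochPhase (k x : TorusSite 2 L) : ℂ := ZMod.stdAddChar (torusDot L k x)

/-- **The spin structure operator `𝓢_s(q) = Σ_{x,y} e^{iq·x} e^{-iq·y} 𝐒_x·𝐒_y`** at `q = 2πk/L`
(`⟨ψ, 𝓢_s(q) ψ⟩ = L² · S_s(q)` in a unit vector). Hirsch 1985 eq. (4.7); M3.md §2(iii). -/
def spinStructureOp (k : TorusSite 2 L) :
    Matrix (Finset (Orb (FermionTorus 2 L))) (Finset (Orb (FermionTorus 2 L))) ℂ :=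
  ∑ x : TorusSite 2 L, ∑ y : TorusSite 2 L,
    (blochPhase L k x * star (blochPhase L k y)) • fermionSpinDot (ofTorusSite x) (ofTorusSite y)

/-- **The density structure operator `𝓢_c(q) = Σ_{x,y} e^{iq·x} e^{-iq·y} n_x n_y`** at `q = 2πk/L`.
Hirsch 1985 eq. (4.7); M3.md §2(iii). -/
def densityStructureOp (k : TorusSite 2 L) :
    Matrix (Finset (Orb (FermionTorus 2 L))) (Finset (Orb (FermionTorus 2 L))) ℂ :=
  ∑ x : TorusSite 2 L, ∑ y : TorusSite 2 L,
    (blochPhase L k x * star (blochPhase L k y)) • (siteDensity (ofTorusSite x) * siteDensity (ofTorusSite y))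

/-- **`S_s(q; ψ) = Re ⟨ψ, 𝓢_s(q) ψ⟩ / L²`**, the spin structure factor of a torus vector (row id
`Ss.q<label>`; `m_s² = S_s(π,π)/L²`). -/
def spinStructureFactor (k : TorusSite 2 L) (ψ : Fock (Orb (FermionTorus 2 L))) : ℝ :=
  (expect (spinStructureOp L k) ψ).re / (L : ℝ) ^ 2

/-- **`S_c(q; ψ) = Re ⟨ψ, 𝓢_c(q) ψ⟩ / L²`**, the (non-connected) density structure factor of a torus
vector (row id `Sc.q<label>`; equals the connected one at `q ≠ 0` in a translation-invariant state of
fixed particle number). -/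
def densityStructureFactor (k : TorusSite 2 L) (ψ : Fock (Orb (FermionTorus 2 L))) : ℝ :=
  (expect (densityStructureOp L k) ψ).re / (L : ℝ) ^ 2

/-! ### Bloch phases -/

omit [NeZero L] in
/-- `k·(x + y) = k·x + k·y`. -/
theorem torusDot_add_right (k x y : TorusSite 2 L) :
    torusDot L k (x + y) = torusDot L k x + torusDot L k y := by
  simp only [torusDot, Pi.add_apply, mul_add, Finset.sum_add_distrib]

omit [NeZero L] in
/-- `k·(-x) = -(k·x)`. -/
theorem torusDot_neg_right (k x : TorusSite 2 L) : torusDot L k (-x) = -torusDot L k x := by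
  simp only [torusDot, Pi.neg_apply, mul_neg, Finset.sum_neg_distrib]

/-- `e^{iq·(x+y)} = e^{iq·x} e^{iq·y}`. -/
theorem blochPhase_add (k x y : TorusSite 2 L) :
    blochPhase L k (x + y) = blochPhase L k x * blochPhase L k y := by
  rw [blochPhase, blochPhase, blochPhase, torusDot_add_right, AddChar.map_add_eq_mul]

/-- `|e^{iq·x}| = 1`. -/
theorem norm_blochPhase (k x : TorusSite 2 L) : ‖blochPhase L k x‖ = 1 := by
  rw [blochPhase, ZMod.stdAddChar_apply]
  exact Circle.norm_coe _

/-- `e^{iq·x} e^{-iq·x} = 1`. -/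
theorem blochPhase_mul_star_self (k x : TorusSite 2 L) :
    blochPhase L k x * star (blochPhase L k x) = 1 := by
  rw [Complex.star_def, Complex.mul_conj, Complex.normSq_eq_norm_sq, norm_blochPhase]
  simp

/-- `e^{iq·(-x)} = e^{-iq·x} = conj e^{iq·x}`. -/
theorem blochPhase_neg (k x : TorusSite 2 L) : blochPhase L k (-x) = star (blochPhase L k x) := by
  have h : blochPhase L k (-x) = (blochPhase L k x)⁻¹ := by
    rw [blochPhase, blochPhase, torusDot_neg_right, AddChar.map_neg_eq_inv]
  rw [h, Complex.inv_eq_conj (norm_blochPhase L k x), Complex.star_def]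

/-- `e^{iq·0} = 1`. -/
theorem blochPhase_zero_right (k : TorusSite 2 L) : blochPhase L k 0 = 1 := by
  have h : torusDot L k 0 = 0 := by simp [torusDot]
  rw [blochPhase, h, AddChar.map_zero_eq_one]

/-- **`Re e^{iq·x} = cos (2π (k·x)/L)`** (`(k·x).val ∈ [0, L)` the canonical representative). -/
theorem re_blochPhase (k x : TorusSite 2 L) :
    (blochPhase L k x).re = Real.cos (2 * Real.pi * ((torusDot L k x).val : ℝ) / L) := by
  rw [blochPhase, ZMod.stdAddChar_apply, ZMod.toCircle_apply]
  have hz : (2 * (Real.pi : ℂ) * Complex.I * ((torusDot L k x).val : ℂ) / (L : ℂ)) =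
      ((2 * Real.pi * ((torusDot L k x).val : ℝ) / L : ℝ) : ℂ) * Complex.I := by
    push_cast
    ring
  rw [hz, Complex.exp_ofReal_mul_I_re]

/-! ### `W_{-r} = W_r`, `N_{-r} = N_r`, the `r = 0` sum rule -/

/-- **`W_{-r} = W_r`** (reindex `x ↦ x + r` and `𝐒_x·𝐒_y = 𝐒_y·𝐒_x`). -/
theorem spinCorrSum_neg (r : TorusSite 2 L) : spinCorrSum L (-r) = spinCorrSum L r := by
  unfold spinCorrSum
  conv_lhs => rw [← Equiv.sum_comp (Equiv.addRight r)]
  refine Fintype.sum_congr _ _ fun x => ?_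
  rw [Equiv.coe_addRight, add_neg_cancel_right, fermionSpinDot_comm]

/-- **`N_{-r} = N_r`** (reindex; densities commute). -/
theorem densityCorrSum_neg (r : TorusSite 2 L) : densityCorrSum L (-r) = densityCorrSum L r := by
  unfold densityCorrSum
  conv_lhs => rw [← Equiv.sum_comp (Equiv.addRight r)]
  refine Fintype.sum_congr _ _ fun x => ?_
  rw [Equiv.coe_addRight, add_neg_cancel_right, (siteDensity_commute _ _).eq]

/-- **`W_0 = (3/4) Σ_x m_x`** with `m_x = (n_{x↑} - n_{x↓})²` the local moment (`𝐒_x·𝐒_x = ¾ m_x`):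
the `r = 0` entry of every truncated structure factor is the local-moment density. -/
theorem spinCorrSum_zero :
    spinCorrSum L 0 = (3 / 4 : ℂ) • ∑ x : TorusSite 2 L, FermionSpinMoment.localMoment (ofTorusSite x) := by
  simp only [spinCorrSum, add_zero, FermionSpinMoment.fermionSpinDot_self, Finset.smul_sum]

/-! ### Fourier dictionary: `𝓢(q) = Σ_r e^{-iq·r} W_r = Σ_r cos(q·r) W_r` -/

/-- **`𝓢_s(q) = Σ_r e^{-iq·r} W_r`** (substitute `y = x + r`, `e^{iq·x} e^{-iq·(x+r)} = e^{-iq·r}`). -/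
theorem spinStructureOp_eq_sum_smul_spinCorrSum (k : TorusSite 2 L) :
    spinStructureOp L k = ∑ r : TorusSite 2 L, star (blochPhase L k r) • spinCorrSum L r := by
  have h : ∀ x : TorusSite 2 L,
      ∑ y : TorusSite 2 L, (blochPhase L k x * star (blochPhase L k y)) •
          fermionSpinDot (ofTorusSite x) (ofTorusSite y) =
        ∑ r : TorusSite 2 L, star (blochPhase L k r) • fermionSpinDot (ofTorusSite x) (ofTorusSite (x + r)) := by
    intro x
    rw [← Equiv.sum_comp (Equiv.addLeft x)]
    refine Fintype.sum_congr _ _ fun r => ?_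
    rw [Equiv.coe_addLeft, blochPhase_add, star_mul', ← mul_assoc, blochPhase_mul_star_self, one_mul]
  calc spinStructureOp L k
      = ∑ x : TorusSite 2 L, ∑ r : TorusSite 2 L,
          star (blochPhase L k r) • fermionSpinDot (ofTorusSite x) (ofTorusSite (x + r)) :=
        Finset.sum_congr rfl fun x _ => h x
    _ = ∑ r : TorusSite 2 L, ∑ x : TorusSite 2 L,
          star (blochPhase L k r) • fermionSpinDot (ofTorusSite x) (ofTorusSite (x + r)) := Finset.sum_comm
    _ = ∑ r : TorusSite 2 L, star (blochPhase L k r) • spinCorrSum L r := by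
        simp only [spinCorrSum, Finset.smul_sum]

/-- **`𝓢_c(q) = Σ_r e^{-iq·r} N_r`**. -/
theorem densityStructureOp_eq_sum_smul_densityCorrSum (k : TorusSite 2 L) :
    densityStructureOp L k = ∑ r : TorusSite 2 L, star (blochPhase L k r) • densityCorrSum L r := by
  have h : ∀ x : TorusSite 2 L,
      ∑ y : TorusSite 2 L, (blochPhase L k x * star (blochPhase L k y)) •
          (siteDensity (ofTorusSite x) * siteDensity (ofTorusSite y)) =
        ∑ r : TorusSite 2 L, star (blochPhase L k r) •
          (siteDensity (ofTorusSite x) * siteDensity (ofTorusSite (x + r))) := by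
    intro x
    rw [← Equiv.sum_comp (Equiv.addLeft x)]
    refine Fintype.sum_congr _ _ fun r => ?_
    rw [Equiv.coe_addLeft, blochPhase_add, star_mul', ← mul_assoc, blochPhase_mul_star_self, one_mul]
  calc densityStructureOp L k
      = ∑ x : TorusSite 2 L, ∑ r : TorusSite 2 L, star (blochPhase L k r) •
          (siteDensity (ofTorusSite x) * siteDensity (ofTorusSite (x + r))) :=
        Finset.sum_congr rfl fun x _ => h x
    _ = ∑ r : TorusSite 2 L, ∑ x : TorusSite 2 L, star (blochPhase L k r) •
          (siteDensity (ofTorusSite x) * siteDensity (ofTorusSite (x + r))) := Finset.sum_comm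
    _ = ∑ r : TorusSite 2 L, star (blochPhase L k r) • densityCorrSum L r := by
        simp only [densityCorrSum, Finset.smul_sum]

/-- `e^{iq·r} + e^{-iq·r} = 2 cos(q·r)`. -/
private theorem blochPhase_add_star (k r : TorusSite 2 L) :
    blochPhase L k r + star (blochPhase L k r) = (2 : ℂ) * (((blochPhase L k r).re : ℝ) : ℂ) := by
  rw [Complex.star_def, Complex.add_conj]
  push_cast
  ring

/-- From `A = Σ_r e^{-iq·r} B_r` and `B_{-r} = B_r`: `A = Σ_r cos(q·r) B_r` (generic step). -/
private theorem eq_sum_re_smul_of_eq_sum_star_smul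
    {A : Matrix (Finset (Orb (FermionTorus 2 L))) (Finset (Orb (FermionTorus 2 L))) ℂ}
    {B : TorusSite 2 L → Matrix (Finset (Orb (FermionTorus 2 L))) (Finset (Orb (FermionTorus 2 L))) ℂ}
    (k : TorusSite 2 L) (hA : A = ∑ r : TorusSite 2 L, star (blochPhase L k r) • B r)
    (hB : ∀ r, B (-r) = B r) :
    A = ∑ r : TorusSite 2 L, (((blochPhase L k r).re : ℝ) : ℂ) • B r := by
  have h2 : A = ∑ r : TorusSite 2 L, blochPhase L k r • B r := by
    rw [hA, ← Equiv.sum_comp (Equiv.neg (TorusSite 2 L))]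
    refine Fintype.sum_congr _ _ fun r => ?_
    rw [Equiv.neg_apply, blochPhase_neg, star_star, hB]
  have h3 : (2 : ℂ) • A = (2 : ℂ) • ∑ r : TorusSite 2 L, (((blochPhase L k r).re : ℝ) : ℂ) • B r :=
    calc (2 : ℂ) • A = A + A := two_smul _ _
      _ = (∑ r : TorusSite 2 L, blochPhase L k r • B r) +
            ∑ r : TorusSite 2 L, star (blochPhase L k r) • B r := by rw [← h2, ← hA]
      _ = ∑ r : TorusSite 2 L, (blochPhase L k r + star (blochPhase L k r)) • B r := by
          rw [← Finset.sum_add_distrib]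
          simp only [add_smul]
      _ = ∑ r : TorusSite 2 L, (2 : ℂ) • ((((blochPhase L k r).re : ℝ) : ℂ) • B r) :=
          Finset.sum_congr rfl fun r _ => by rw [blochPhase_add_star, mul_smul]
      _ = (2 : ℂ) • ∑ r : TorusSite 2 L, (((blochPhase L k r).re : ℝ) : ℂ) • B r := Finset.smul_sum.symm
  exact smul_right_injective _ two_ne_zero h3

/-- **`𝓢_s(q) = Σ_r cos(2π (k·r)/L) W_r`** — the cosine (star-symmetrised) weights. -/
theorem spinStructureOp_eq_sum_re_smul (k : TorusSite 2 L) :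
    spinStructureOp L k = ∑ r : TorusSite 2 L, (((blochPhase L k r).re : ℝ) : ℂ) • spinCorrSum L r :=
  eq_sum_re_smul_of_eq_sum_star_smul L k (spinStructureOp_eq_sum_smul_spinCorrSum L k) (spinCorrSum_neg L)

/-- **`𝓢_c(q) = Σ_r cos(2π (k·r)/L) N_r`**. -/
theorem densityStructureOp_eq_sum_re_smul (k : TorusSite 2 L) :
    densityStructureOp L k = ∑ r : TorusSite 2 L, (((blochPhase L k r).re : ℝ) : ℂ) • densityCorrSum L r :=
  eq_sum_re_smul_of_eq_sum_star_smul L k (densityStructureOp_eq_sum_smul_densityCorrSum L k)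
    (densityCorrSum_neg L)

/-- `⟨ψ, 𝓢_s(q) ψ⟩ = Σ_r cos(q·r) ⟨ψ, W_r ψ⟩`. -/
theorem expect_spinStructureOp (k : TorusSite 2 L) (ψ : Fock (Orb (FermionTorus 2 L))) :
    expect (spinStructureOp L k) ψ =
      ∑ r : TorusSite 2 L, (((blochPhase L k r).re : ℝ) : ℂ) * expect (spinCorrSum L r) ψ := by
  rw [spinStructureOp_eq_sum_re_smul, expect_sum]
  exact Finset.sum_congr rfl fun r _ => expect_smul _ _ _

/-- `⟨ψ, 𝓢_c(q) ψ⟩ = Σ_r cos(q·r) ⟨ψ, N_r ψ⟩`. -/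
theorem expect_densityStructureOp (k : TorusSite 2 L) (ψ : Fock (Orb (FermionTorus 2 L))) :
    expect (densityStructureOp L k) ψ =
      ∑ r : TorusSite 2 L, (((blochPhase L k r).re : ℝ) : ℂ) * expect (densityCorrSum L r) ψ := by
  rw [densityStructureOp_eq_sum_re_smul, expect_sum]
  exact Finset.sum_congr rfl fun r _ => expect_smul _ _ _

/-- **`S_s(q; ψ) = Σ_r cos(2π (k·r)/L) · C_s(r; ψ)`** — the structure factor is the cosine transform
of the per-displacement correlator table (the assembly rule of the cell's `Sstrunc` / `Ss` rows). -/
theorem spinStructureFactor_eq_sum_cos_mul_spinCorr (k : TorusSite 2 L) (ψ : Fock (Orb (FermionTorus 2 L))) :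
    spinStructureFactor L k ψ =
      ∑ r : TorusSite 2 L, Real.cos (2 * Real.pi * ((torusDot L k r).val : ℝ) / L) * spinCorr L r ψ := by
  unfold spinStructureFactor spinCorr
  rw [expect_spinStructureOp, Complex.re_sum, Finset.sum_div]
  refine Finset.sum_congr rfl fun r _ => ?_
  rw [Complex.re_ofReal_mul, re_blochPhase, mul_div_assoc]

/-- **`S_c(q; ψ) = Σ_r cos(2π (k·r)/L) · C_c(r; ψ)`**. -/
theorem densityStructureFactor_eq_sum_cos_mul_densityCorr (k : TorusSite 2 L)
    (ψ : Fock (Orb (FermionTorus 2 L))) :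
    densityStructureFactor L k ψ =
      ∑ r : TorusSite 2 L, Real.cos (2 * Real.pi * ((torusDot L k r).val : ℝ) / L) * densityCorr L r ψ := by
  unfold densityStructureFactor densityCorr
  rw [expect_densityStructureOp, Complex.re_sum, Finset.sum_div]
  refine Finset.sum_congr rfl fun r _ => ?_
  rw [Complex.re_ofReal_mul, re_blochPhase, mul_div_assoc]

end Torus

/-! ## The `4 × 4` bridge -/

section Four

/-- `FermionTorus.equivTorusSite` is `toTorusSite` (definitional). -/
private theorem equivTorusSite_apply' {L : ℕ} [NeZero L] (x : FermionTorus 2 L) :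
    FermionTorus.equivTorusSite x = toTorusSite x := rfl

/-- The general Bloch phase at `L = 4` is the `4 × 4` file's `blochPhaseFour`. -/
theorem blochPhase_four_eq (k : TorusSite 2 4) (x : FermionTorus 2 4) :
    blochPhase 4 k (toTorusSite x) =
      Summit.HubbardSuperconductivity.HubbardLadder.blochPhaseFour (ofTorusSite k) x := by
  rw [blochPhase, Summit.HubbardSuperconductivity.HubbardLadder.blochPhaseFour, torusDot, Fin.sum_univ_two,
    toTorusSite_apply, toTorusSite_apply]
  have h : (k 0 * (((ofLex x 0 : Fin 4) : ℕ) : ZMod 4) + k 1 * (((ofLex x 1 : Fin 4) : ℕ) : ZMod 4)) =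
      ((((ofLex (ofTorusSite k) 0 : Fin 4) : ℕ) * ((ofLex x 0 : Fin 4) : ℕ) +
        ((ofLex (ofTorusSite k) 1 : Fin 4) : ℕ) * ((ofLex x 1 : Fin 4) : ℕ) : ℕ) : ZMod 4) := by
    rw [ofLex_ofTorusSite_apply, ofLex_ofTorusSite_apply]
    push_cast
    rw [ZMod.natCast_zmod_val, ZMod.natCast_zmod_val]
  rw [h, ZMod.stdAddChar_apply, ZMod.toCircle_natCast]
  congr 1
  push_cast
  ring

/-- **`L = 4`: the general spin structure operator is the `4 × 4` file's `spinStructureFour`**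
(momentum index `k ∈ (ℤ/4ℤ)²` ↔ `ofTorusSite k`), so every `4 × 4` row and the certificate-free
theorems `norm_expect_spinStructureFour_le` / `spinStructureFour_pi_pi` apply verbatim. -/
theorem spinStructureOp_four (k : TorusSite 2 4) :
    spinStructureOp 4 k = Summit.HubbardSuperconductivity.HubbardLadder.spinStructureFour (ofTorusSite k) := by
  unfold spinStructureOp Summit.HubbardSuperconductivity.HubbardLadder.spinStructureFour
  symm
  refine Fintype.sum_equiv FermionTorus.equivTorusSite _ _ fun x => ?_
  refine Fintype.sum_equiv FermionTorus.equivTorusSite _ _ fun y => ?_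
  rw [equivTorusSite_apply', equivTorusSite_apply', ofTorusSite_toTorusSite, ofTorusSite_toTorusSite,
    blochPhase_four_eq, blochPhase_four_eq]

/-- Hence `S_s(q; ψ)` at `L = 4` is `Re ⟨ψ, spinStructureFour q ψ⟩ / 16`. -/
theorem spinStructureFactor_four (k : TorusSite 2 4) (ψ : Fock (Orb (FermionTorus 2 4))) :
    spinStructureFactor 4 k ψ =
      (expect (Summit.HubbardSuperconductivity.HubbardLadder.spinStructureFour (ofTorusSite k)) ψ).re / 16 := by
  rw [spinStructureFactor, spinStructureOp_four]
  norm_num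

end Four

end Summit.Ventures.CertifiedManyBodySolver.Observables
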